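import Mathlib
import HarnessLib
import HarnessLib.Audit
import Summits.AtomisticToContinuum.Statement
import Literature.MathematicalPhysics.KineticTheory.LangevinChainKernel
import Literature.MathematicalPhysics.KineticTheory.LangevinChainGibbs
import Literature.MathematicalPhysics.KineticTheory.InfiniteChainDynamics
import Literature.Barriers.AtomisticToContinuum.MacroErgodicityHypothesis
import Summits.AtomisticToContinuum.FouriersLaw.Theorems.EmbeddedDrudeMourreNessUnique
import Summits.AtomisticToContinuum.FouriersLaw.Theorems.FourierGreenKuboFourierFiniteResponseOfUnique

/-!
Route: AbelianSqueeze

CLOSED (retired) 2026-08-15T13:38:20Z by operator:999:1257524 — reason: not-a-thesis: assembly does not conclude the sub-problem Statement — note: D-0027 §2.1 audit (human 2026-08-15: routes that do not decide the summit are removed): the assembly concludes `Literature.MathematicalPhysics.KineticTheory.HeatConduction.FouriersLaw`, not the sub-problem statement; a NEW conforming route may be opened from the same idea (generated `closes : … → _r. The file is kept as the record of this route; refuted decls are indexed as negative knowledge (`ledger negatives`).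

# Route AbelianSqueeze — glued Green–Kubo optimisers squeeze the open chain's resolvent at every ν>0
by statics; D_N converges once one uniform low-frequency estimate holds

X_AS (ABELIAN SQUEEZE; realises idea card
AtomisticToContinuum/FouriersLaw/abelian-squeeze-thermodynamic-limit, sharpened so that NO
infinite-volume dynamics is ever needed). Fix pinnedChain ω₂ lam β γ (all > 0) and T > 0. Finite N:
J := Σ_i bondCurrent N i, μ_N := gibbsMeasure N T,
P_t := the CONSTRUCTED transition kernels `transitionKernel N T T t` (both baths at T), c_N(t) := ∫
J·(P_t J) dμ_N and F_N(ν) := ∫₀^∞ e^(−νt) c_N(t) dt.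
Infinite chain, STATICS ONLY: for the shift-invariant DLR state μ_T, the bracket ⟨⟨f,g⟩⟩ := Σ_x
Cov_μT(f, g∘τ_x), j := bondCurrentZ · 0, 𝒜 := liouvilleZ,
PRIMAL_ν(g) := 2⟨⟨j,g⟩⟩ − ν⟨⟨g,g⟩⟩ − ν⁻¹⟨⟨𝒜g,𝒜g⟩⟩ and DUAL_ν(u) := ν⁻¹⟨⟨j+𝒜u,j+𝒜u⟩⟩ + ν⟨⟨u,u⟩⟩ over
local test functions (IsLocalTestFunction).
It suffices to show X_AS := (K) KuboAbelIdentity: (N−1)T²D_N = ∫₀^∞ c_N (Kundu–Dhar–Narayan) ∧ (S)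
ResolventSqueeze: for every ν > 0 and local g, u,
(N−1)(PRIMAL_ν(g) − ε) ≤ F_N(ν) ≤ (N−1)(DUAL_ν(u) + ε) for N large (glued translates of g, u as
primal and dual witnesses) ∧ (G) LiouvilleNoGap:
sup PRIMAL_ν = inf DUAL_ν ∧ (R) UniformAbelianRegularity: lim_(ν→0) limsup_N N⁻¹|∫₀^∞(1 − e^(−νt))
c_N| = 0 ∧ (P) ConductanceLowerBound (shared stmt-2193).
Then T²D_N is squeezed into [K_ν − o(1), K_ν + o(1)] up to the uniform error of (R), hence Cauchy:
D_N → κ(T) := K_(0⁺)/T² > 0, and with the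
shared supports NessUnique (0741), FiniteResponseOfUnique (0717) and the landed fact
CuneoEckmannHairerReyBellet2018_pinnedChain, FouriersLaw.
Lean: `KuboAbelIdentity ∧ ResolventSqueeze ∧ LiouvilleNoGap ∧ UniformAbelianRegularity ∧
ConductanceLowerBound`

## Assembly
Real analysis, no mathematics of the chain (the prover imports LangevinChainNESSHolds for clause
(i)). Fix parameters; clause (i) = CuneoEckmannHairerReyBellet2018_pinnedChain_holds
(existence, N ≥ 1; isSteadyState_zero for N = 0) + NessUnique. Clause (ii): choose the steady-state
family of clause (i) and D₀ N from FiniteResponseOfUnique; by KuboAbelIdentity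
T²·D₀ N = (N−1)⁻¹∫₀^∞ c_N; pick μ_T from ShiftInvariantGibbsState; for ε > 0 take ν < ν₀(ε)
(UniformAbelianRegularity), then g, u from LiouvilleNoGap at (ν, ε), then N large
(ResolventSqueeze at g, u, ε and the N₀ of (R)): T²D₀ N ∈ [PRIMAL_ν(g) − 3ε, PRIMAL_ν(g) + 4ε], so
(D₀ N) is Cauchy and converges to some ℓ(T); ConductanceLowerBound gives ℓ(T) ≥ c > 0;
set κ T := ℓ(T) (T > 0). For an arbitrary steady-state family uniqueness identifies it with the
chosen one at positive temperatures, so its response limits are the same D₀ N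
(tendsto_nhds_unique), and fouriersLaw_of_steadyState_and_linearResponse-style unfolding gives
FouriersLawFor, for all parameters FouriersLaw. GibbsKernelInvariant and
GeneratorCore are prover inputs of (S)/(K), not antecedents.

Rationale: WHY THIS LINE. BLR's κ takes δT → 0 first, so D_N is an EQUILIBRIUM resolvent-at-0⁺ of the accretive
open generator L_N = 𝒜_N + γS (KunduDharNarayan2009: (N−1)T²D_N = ∫₀^∞⟨J(0)J(t)⟩_N);
at ν > 0 both F_N(ν) = ⟨J,(ν−L_N)⁻¹J⟩ and the infinite-chain value have exact TWO-SIDED variational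
forms (BernardinOlla2011 §6 eq. (var), KomorowskiLandimOlla2012 Ch. 2),
and we import the homogenisation move 'box coefficient = cell value by inserting the corrector as
primal witness and its flux as dual witness, boundary = lower order'
(ArmstrongKuusiMourrat2019 ν/ν*, LandimOllaVaradhan2002 and Jara2006 for exclusion) with the
dictionary box ↦ N-chain, cell problem ↦ static ℋ₀ variational value over
LOCAL functions, boundary layer ↦ the two thermostatted sites: since 𝒜 is local, (ν−γS)⁻¹ ≤ ν⁻¹ and
S touches two sites, every gluing error is an O(ℓ) boundary term
against an O(N) bulk, so open and closed resolvents agree per unit length at EVERY ν > 0 with no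
rate, no decay and no infinite-volume flow (this is what FourierGreenKubo's
plan for 0742 — 'N-uniform decay + boundary layers' — and the finite-volume series-law routes
Fekete/SuperadditiveJunction do not do). All transport difficulty is
re-concentrated in ONE statement, equicontinuity of the open chain's current spectral density at
frequency 0 uniformly in N (crux R = sharp HasBoundedResponse), plus
the ℋ₀-core property of the Liouvillian (crux G, printed only as an assumption for unbounded V″:
BernardinOlla2011 p. 11) and positivity (shared crux P).

RANKED CRUXES. #2 UniformAbelianRegularity (crux) — (R) for pinnedChain (all > 0) and T > 0: for
every ε > 0 there is ν₀ > 0 such that for all ν ∈ (0, ν₀), eventually in N, |∫₀^∞ (1 − e^(−νt))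
c_N(t) dt| ≤ εN — the low-frequency (slow) part of the open chain's equilibrium total-current
autocorrelation carries o(N) weight uniformly; given (K),(S),(G) it is EQUIVALENT to convergence of
D_N (card crux 3, the shared finiteness residual in Abelian form). [deps: KuboAbelIdentity]
[difficulty: open-problem] (why it might fail: This IS the finiteness content (sharp
HasBoundedResponse, Abelian form): slow hydrodynamic or breather modes may put ≳N weight below
frequency ν (L² gap ~ N⁻³, BeckerMenegaki2022); it fails outright at lam = β = 0, where ∫₀^∞ c_N ~
N² (ballistic).) [BonettoLebowitzReyBellet2000, BeckerMenegaki2022, KunduDharNarayan2009, Dhar2008,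
Literature.Barriers.AtomisticToContinuum.HasBoundedResponse]
#3 ResolventSqueeze (crux) — (S) for pinnedChain (all > 0), T > 0, the shift-invariant DLR Gibbs
state μ_T, every ν > 0 and all local test functions g, u: for every ε > 0, eventually in N,
(N−1)(PRIMAL_ν(g) − ε) ≤ F_N(ν) ≤ (N−1)(DUAL_ν(u) + ε). Proof plan: weak-duality at fixed N (F ≥
2⟨J,g_N⟩ − ‖g_N‖²_(ν−γS) − ν⁻¹‖𝒜_N g_N‖² via (‖h−g‖ − ‖𝒜g‖_*)² ≥ 0 and F ≤ ν⁻¹‖J + 𝒜_N u_N‖² +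
‖u_N‖²_(ν−γS) via the test vector h − u), with g_N, u_N = sums of interior translates; Cov(j_b, τ_x
g) = 0 unless windows meet, E[𝒜_N f] = 0 exactly, exponential q-mixing of the 1-D Gibbs chain
uniformly in N (card crux 1). [deps: GeneratorCore, GibbsKernelInvariant, ShiftInvariantGibbsState]
[difficulty: L] (why it might fail: Only via infrastructure: the L²(Gibbs) semigroup of the
constructed kernels must be generated by the closure of L on C_c^∞ (GeneratorCore), Gibbs
kernel-invariant, and free-end Gibbs marginals must mix exponentially uniformly in N; else the
O(ℓ)-boundary vs O(N)-bulk bookkeeping is algebra.) [BernardinOlla2011, KomorowskiLandimOlla2012,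
LandimOllaVaradhan2002, Jara2006, ArmstrongKuusiMourrat2019, KunduDharNarayan2009]
#4 LiouvilleNoGap (crux) — (G) for pinnedChain (all > 0), T > 0, the shift-invariant DLR state μ_T
and every ν > 0: for every ε > 0 there are local test functions g, u with DUAL_ν(u) ≤ PRIMAL_ν(g) +
ε (no duality gap; by Fenchel–Rockafellar inf DUAL = sup of PRIMAL over the maximal domain D(𝒜₀*),
so the item says local functions are a core: essential skew-adjointness of the Liouvillian on local
functions in ℋ₀(μ_T), the translation-summed analogue of MarchioroPellegrinottiPulvirenti1978).
[deps: ShiftInvariantGibbsState] [difficulty: L] (why it might fail: Printed only as an ASSUMPTION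
for unbounded V″ (BernardinOlla2011 p. 11/13: 'easily proved if V″ bounded … proofs should be quite
technical'); needs covariance-summed locality of the infinite quartic-coupling dynamics (BCDM 2007:
harmonic coupling only); a deficiency vector = a non-local slow mode.)
[MarchioroPellegrinottiPulvirenti1978, BernardinOlla2011, doi:10.1007/bf01197331,
doi:10.1007/s10955-007-9278-0, LanfordLebowitzLieb1977]
#5 KuboAbelIdentity (crux) — (K) under weak-NESS uniqueness, for every steady-state family, T > 0, N
and every response coefficient D of clause (ii) (D = lim_(δ→0,δ≠0) totalCurrent(μ N (T+δ/2)
(T−δ/2))/δ): t ↦ c_N(t) is integrable on (0,∞) and (N−1)·T²·D = ∫₀^∞ c_N(t) dt — the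
Kundu–Dhar–Narayan open-system Green–Kubo identity G = (k_B T²)⁻¹∫₀^∞⟨j̄(t)j̄(0)⟩dt, j̄ = J/(N−1),
made a theorem for the Langevin-bath pinned chain (N = 0, 1: both sides vanish). [deps: NessUnique,
GibbsKernelInvariant] [difficulty: M] (why it might fail: Needs NESS = invariant law of the
constructed semigroup (FP-identification half of 0741), differentiability of μ_(T±δ/2)(J) at δ = 0
with the exchange of δ→0 and t→∞ (weighted spectral gap, CEHR (2.5)), and KDN's Novikov /
time-reversal steps made honest for polynomially unbounded J.) [KunduDharNarayan2009,
arXiv:0809.4543, ReyBellet2003, HairerMajda2009, CuneoEckmannHairerReyBellet2018,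
BonettoLebowitzReyBellet2000]
#6 ConductanceLowerBound (crux) — (P) NOT INSULATING (shared verbatim with route
SuperadditiveJunction, stmt-AtomisticToContinuum-2193): under weak-NESS uniqueness, for every
steady-state family, T > 0 and response coefficients D_N: ∃ c > 0, N₁ with c ≤ D_N for all N ≥ N₁.
Here it is the positivity input: it makes κ(T) = lim D_N > 0 (the squeeze gives existence of the
limit, not its sign). [difficulty: open-problem] (why it might fail: No N-uniform lower bound on the
NESS current of a deterministic anharmonic chain is in print; asymptotic localisation
(DeRoeckHuveneers2015) makes c(T) super-polynomially small at low T·lam; a genuine failure (D_N → 0)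
would refute the conjunct itself.) [DeRoeckHuveneers2015, BonettoLebowitzReyBellet2000,
BernardinOlla2005, Dhar2008]
#9 NessUnique (support) — shared item stmt-AtomisticToContinuum-0741 (verbatim): weak Fokker–Planck
steady states of pinnedChain are unique for all N, T_L, T_R > 0; hypothesis of (K) and of clause
(i). [difficulty: M] [CuneoEckmannHairerReyBellet2018, Carmona2007]
#9 FiniteResponseOfUnique (support) — shared item stmt-AtomisticToContinuum-0717 (verbatim): under
weak-NESS uniqueness the finite-N response limits D_N exist. [difficulty: M] [ReyBellet2003,
HairerMajda2009, CuneoEckmannHairerReyBellet2018]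
#9 ShiftInvariantGibbsState (support) — for pinnedChain (all > 0) and T > 0 a shift-invariant DLR
Gibbs state μ_T on (ℝ×ℝ)^ℤ exists (1-D transfer operator e^(−U/2T)e^(−V(q′−q)/T)e^(−U/2T),
Hilbert–Schmidt with simple top eigenvalue; momenta i.i.d. Gaussian). It instantiates μT in (S),(G);
uniqueness among shift-invariant DLR states (tight boundary values + uniform forgetting) is a lemma
of the (S)-prover, not an item. [difficulty: provable-now] [LanfordLebowitzLieb1977,
KomorowskiLandimOlla2012]
#9 GibbsKernelInvariant (support) — at equal bath temperatures the Gibbs measure gibbsMeasure N T is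
invariant under the constructed transition kernels transitionKernel N T T t for every t (so P_t is a
contraction semigroup on L²(μ_N) and F_N(ν), c_N are junk-free); infinitesimal invariance is in tree
(pinnedChain_isSteadyState_gibbsMeasure). [difficulty: M] [CuneoEckmannHairerReyBellet2018,
BonettoLebowitzReyBellet2000]
#9 GeneratorCore (support) — essential m-dissipativity of the equal-temperature generator L = 𝒜_H +
γS on C_c^∞ in L²(gibbsMeasure N T): for ν > 0, an L² function orthogonal to (ν − L)C_c^∞ vanishes;
hence the L² semigroup of the constructed kernels is generated by the closure of L, L̄* ⊇ (−𝒜_H +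
γS)|C_c^∞, Re⟨L̄h,h⟩ = −γT Σ_bath‖∂_p h‖² — the functional-analytic input of the fixed-N
weak-duality inequalities in (S). Energy cut-offs χ(H/k) commute with 𝒜_H exactly. [difficulty: M]
[doi:10.1007/b104762, doi:10.1007/s00028-010-0064-0, BernardinOlla2011]

TWO-LAYER PLAN. (R) ⇐ R_lower → R_upper → R with R_lower := liminf_N N⁻¹∫(1−e^(−νt))c_N ≥ −ε (free
under OpenCurrentPositivity c_N(t) ≥ 0, card crux 2 'PositivityHalf', itself a
candidate child) and R_upper := the limsup half (= sharp HasBoundedResponse; suppliers: routes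
LocalOhmRigidity / EscapeDeficit, cards tangent-flow-self-dephasing,
background-method-sos-certificates). (S) ⇐ FixedNWeakDuality (both test-function inequalities for
the constructed semigroup) → StaticGluing (boundary bookkeeping) → S.
(G) ⇐ CovarianceSummedLocality (ring-uniform almost-finite propagation, card ring-green-kubo-bypass
(RL)) → CoreFromLocality → G; the same locality lemma yields the
support item AbelBridgeToGreenKubo: for any shift-covariant μ_T-preserving local dynamics D,
PRIMAL_ν ≤ ∫₀^∞e^(−νt)C_T^D(t)dt ≤ DUAL_ν, hence under (G) and HasGreenKubo
κ = κ_GK (FourierGreenKubo item 0742 becomes a corollary) — filed only once (RL) or 0743 lands.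

KILL CRITERIA. (S) false already for the harmonic member (lam = β = 0, where PRIMAL/DUAL are
explicit: g = j/ν, u = 0, K_ν = Σ_x Cov(j₀,j_x)/ν) kills the line outright: close
refuted:ResolventSqueeze. A deficiency of the local Liouvillian in ℋ₀ (¬G) forces a pivot to the
asymptotic form lim_(ν→0)(inf DUAL_ν − sup PRIMAL_ν) = 0 (restate G).
¬(R) with (K),(S),(G) proved means D_N does not converge — then FouriersLaw itself is false (file
¬FouriersLaw); ¬(P) likewise refutes the conjunct. If route
FourierGreenKubo closes 0742 and 0703 first, this route is superseded (its κ equals κ_GK by the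
bridge).

NOT DECOMPOSED YET. The engine for (R) (deliberately: it is the shared residual of every FouriersLaw
line and has four external suppliers); the locality lemma behind (G); the fixed-N
linear-response technology inside (K) (Hairer–Majda transfer, FP-identification) which is shared
with 0717/0741; uniqueness of the shift-invariant DLR state and the
N-uniform transfer-operator mixing (lemmas riding with (S) via --supports); T-dependence/continuity
of κ; the AbelBridgeToGreenKubo support item (see Two-layer plan).

CHEAPEST FALSIFIER. Harmonic calibration, exact linear algebra: for lam = β = 0 the open chain is an
OU process, F_N(ν) = 2 tr(QΣWΣ) with (Mᵀ−ν/2)W + W(M−ν/2) = −Q (2N×2N Sylvester), and the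
static prediction is K_ν = s/ν, s = T(E r₀² + E r₀r₁)/2 from the Gaussian DLR state (𝒜j is an exact
lattice gradient, so g = j/ν, u = 0 are exact optimisers and (G) holds
trivially). Check F_N(ν)/(N−1) → s/ν for N = 8…512, ν ∈ {1, 0.3, 0.1, 0.03} while F_N(0⁺)/(N−1)
grows like N ((R) must visibly FAIL there). Script written and kept in the
planner folder (harmonic_squeeze.py, numpy/scipy, < 10 s); NOT run at filing: `kit compute submit`
answered 'computed socket absent' (compute daemon down) — refuters run it first.

NUMBERS. KDN normalisation: G_N = J̃/δT = (k_BT²)⁻¹∫₀^∞⟨j̄(t)j̄(0)⟩dt with j̄ = J/(N−1)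
(arXiv:0809.4543 eq. after (reln3)), i.e. (N−1)T²D_N = ∫₀^∞ c_N. Open harmonic chain: L²
spectral gap of exact order N⁻³ (BeckerMenegaki2022 Thm 1), ballistic D_N = (N−1)·c_N(ω₂,γ)
(HarmonicChainBallisticFlux). BO2011 Prop. 4 (velocity-flip chain):
κ(T) ≤ Var(V′(r₀))/(4γT) from the dual formula with u = −V(r₁)/2 — the model computation for DUAL
witnesses. Items at open: 11 (5 cruxes, 5 support, 1 assembly).

DEFINITION REQUESTS. None at open: F_N(ν), c_N are inlined over OscillatorChain.transitionKernel /
gibbsMeasure / bondCurrent, and the ℋ₀ brackets over bondCurrentZ, OscillatorChain.liouvilleZ,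
IsLocalTestFunction, IsShiftInvariant (Literature.Barriers.AtomisticToContinuum.HeatConduction) and
IsChainGibbsMeasure. If a grounder prefers named notions:
`abelResponse` (F_N) next to LangevinSemigroup.lean and `staticBracket`/`abelPrimal`/`abelDual` next
to InfiniteChainDynamics.lean — pure abbreviations of the inlined terms.

Novelty: Searches (2026-08-15): `lit frontier AtomisticToContinuum --since 2020` (30 rows; only
CanestrariLiveraniOlla2026 arXiv:2310.13338 touches deterministic bulk transport);
`lit bridges AtomisticToContinuum --cross any` (30 rows, none on open-vs-closed Kubo
identification); `lit search --source crossref` 'Landim Olla Varadhan finite-dimensional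
approximation self-diffusion' (→ doi:10.1214/aop/1023481000, doi:10.1214/009117906000000449, bib
added) and 'Marchioro Pellegrinotti Pulvirenti selfadjointness Liouville'
(→ doi:10.1007/bf01609415 read pp. 1–2, doi:10.1007/bf01197331 paywalled, acq-02282); `lit read
arXiv:1105.0493` (BO2011 §6 eq. (var) p. 13, γ = 0 form p. 16, standing
assumptions p. 11); `lit read arXiv:0809.4543` pp. 1–3 (KDN identity and normalisation); `lit search
--hybrid` 'variational formula resolvent Green-Kubo conductivity anharmonic
chain upper lower bounds' (8 textbook hits: Spohn1991 p. 217, homogenisation/network-approximation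
books, Gaspard 2022 p. 699 — no open-vs-infinite squeeze); `lit vsearch`
on the thesis sentence (8 textbook hits, none relevant); `lit galaxy search --star all` ×4 phrases
(0 rows; pdf/crabby stars saturated at filing); the 7 route files and ~100
idea cards of the sub (0742 imported by ≥ 8 cards, attacked by none; ring-green-kubo-bypass and
herglotz-current-spectral-measure use ℋ₀ objects at N = ∞ only).
Nearest prior art found: BernardinOlla2011 (arXiv:1105.0493 §6: the sup/inf pair for ⟨g,(λ−L)⁻¹g⟩ on
the velocity-flip chain, incl. γ  [refs: 10.1214/aop/1023481000, 10.1214/009117906000000449, 10.1007/bf01609415, 10.1007/bf01197331, 2310.13338, 1105.0493, 0809.4543, doi:10.1214/aop/1023481000, doi:10.1214/009117906000000449, doi:10.1007/bf01609415, doi:10.1007/bf01197331, CanestrariLiveraniOlla2026, Spohn1991, BernardinOlla2011, LandimOllaVaradhan2002, Jara2006, ArmstrongKuusiMourrat2019, KunduDharNarayan2009, MarchioroPellegrinottiPul]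

Barriers (technique_class: primal-dual-resolvent-squeeze abelian-green-kubo): - technique_class: primal-dual-resolvent-squeeze abelian-green-kubo
- Literature.Barriers.AtomisticToContinuum.HasBoundedResponse: it does not evade it; the bet is that
EVERYTHING ELSE in D_N → κ is soft — the barrier's content is isolated verbatim as crux
UniformAbelianRegularity (rank 2) in its sharp Abelian form and handed to the finiteness suppliers;
the route's own fixed-N ingredients (K, GeneratorCore) claim nothing about N-dependence.
- Literature.Barriers.AtomisticToContinuum.BeckerMenegaki2022_gapClosing: evaded at every ν > 0 —
the squeeze uses no spectral gap, mixing rate or hypocoercive constant of the open chain (the gap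
may close like N⁻³); rates re-enter only through crux (R), as low-frequency equicontinuity rather
than exponential mixing.
- Literature.Barriers.AtomisticToContinuum.Mazur1969_inequality: consistent, not evaded — a local
conserved quantity overlapping j makes sup PRIMAL_ν ≥ ‖Pj‖²/ν, the squeeze still holds at each ν > 0
and exactly crux (R) fails (D_N → ∞); the conjunct would then be false and the route files
¬FouriersLaw.
- Literature.Barriers.AtomisticToContinuum.HarmonicChainBallisticFlux: the calibration case
(Cheapest falsifier): (S),(G),(K) hold with explicit optimisers, (R) fails, so the line cannot prove
too much.
- Literature.Barriers.AtomisticToContinuum.MacroErgodicityBarrier: evaded — no hydrodynamic limit,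
local-equilibrium closure, sector condition or regular-invariant-state classification is used; the
only infinite-volume input is

History (route lifecycle, newest last):
- 2026-08-15T13:38:20Z · CLOSED retired — not-a-thesis: assembly does not conclude the sub-problem Statement (operator:999:1257524)

sub-problem: FouriersLaw · status: closed(retired) · opened planner-plancard-AtomisticToContinuum-Fourier-61cbfeca-0 2026-08-15T11:35:49Z · rev 0 · ledger route-AtomisticToContinuum-AbelianSqueeze
GENERATED by the gate from the ledger (D-0016/17). Provers cite these decls: `theorem foo : Summit.AtomisticToContinuum.FouriersLaw.Theses.AbelianSqueeze.<Decl> := …` in Summits/AtomisticToContinuum/FouriersLaw/Theorems/<Name>.lean.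
-/

namespace Summit.AtomisticToContinuum.FouriersLaw.Theses.AbelianSqueeze

open scoped BigOperators Topology Manifold Classical MeasureTheory ProbabilityTheory Matrix InnerProductSpace ComplexConjugate ContinuousMap
open Filter Set Function TopologicalSpace MeasureTheory

attribute [summit_statement] _root_.FouriersLaw

/-- item stmt-AtomisticToContinuum-4931 · crux · rank 2 · closed · moot by None · by planner
why it might fail: This IS the finiteness content (sharp HasBoundedResponse, Abelian form): slow hydrodynamic or breather modes may put ≳N weight below frequency ν (L² gap ~ N⁻³, BeckerMenegaki2022); it fails outright at lam = β = 0, where ∫₀^∞ c_N ~ N² (ballistic).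
sources: BonettoLebowitzReyBellet2000, BeckerMenegaki2022, KunduDharNarayan2009, Dhar2008, Literature.Barriers.AtomisticToContinuum.HasBoundedResponse
[crux] (R) for pinnedChain (all > 0) and T > 0: for every ε > 0 there is ν₀ > 0 such that for all ν
∈ (0, ν₀), eventually in N, |∫₀^∞ (1 − e^(−νt)) c_N(t) dt| ≤ εN — the low-frequency (slow) part of
the open chain's equilibrium total-current autocorrelation carries o(N) weight uniformly; given
(K),(S),(G) it is EQUIVALENT to convergence of D_N (card crux 3, the shared finiteness residual in
Abelian form). [deps: KuboAbelIdentity] [difficulty: open-problem] -/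
@[route_item "route-AtomisticToContinuum-AbelianSqueeze"]
def UniformAbelianRegularity : Prop :=
  ∀ ω₂ lam β γ : ℝ, 0 < ω₂ → 0 < lam → 0 < β → 0 < γ → ∀ T : ℝ, 0 < T → ∀ ε : ℝ, 0 < ε → ∃ ν₀ : ℝ, 0 < ν₀ ∧ ∀ ν : ℝ, 0 < ν → ν < ν₀ → ∃ N₀ : ℕ, ∀ N : ℕ, N₀ ≤ N → let J : Literature.MathematicalPhysics.KineticTheory.HeatConduction.PhaseSpace N → ℝ := fun z => ∑ i : Fin N, (Literature.MathematicalPhysics.KineticTheory.HeatConduction.pinnedChain ω₂ lam β γ).bondCurrent N i z; |∫ t in Set.Ioi (0:ℝ), (1 - Real.exp (-(ν * t))) * ∫ z, J z * (∫ y, J y ∂((Literature.MathematicalPhysics.KineticTheory.HeatConduction.pinnedChain ω₂ lam β γ).transitionKernel N T T t.toNNReal z)) ∂((Literature.MathematicalPhysics.KineticTheory.HeatConduction.pinnedChain ω₂ lam β γ).gibbsMeasure N T)| ≤ ε * N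

/-- item stmt-AtomisticToContinuum-4932 · crux · rank 3 · closed · moot by None · by planner
why it might fail: Only via infrastructure: the L²(Gibbs) semigroup of the constructed kernels must be generated by the closure of L on C_c^∞ (GeneratorCore), Gibbs kernel-invariant, and free-end Gibbs marginals must mix exponentially uniformly in N; else the O(ℓ)-boundary vs O(N)-bulk bookkeeping is algebra.
sources: BernardinOlla2011, KomorowskiLandimOlla2012, LandimOllaVaradhan2002, Jara2006, ArmstrongKuusiMourrat2019, KunduDharNarayan2009
[crux] (S) for pinnedChain (all > 0), T > 0, the shift-invariant DLR Gibbs state μ_T, every ν > 0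
and all local test functions g, u: for every ε > 0, eventually in N, (N−1)(PRIMAL_ν(g) − ε) ≤ F_N(ν)
≤ (N−1)(DUAL_ν(u) + ε). Proof plan: weak-duality at fixed N (F ≥ 2⟨J,g_N⟩ − ‖g_N‖²_(ν−γS) − ν⁻¹‖𝒜_N
g_N‖² via (‖h−g‖ − ‖𝒜g‖_*)² ≥ 0 and F ≤ ν⁻¹‖J + 𝒜_N u_N‖² + ‖u_N‖²_(ν−γS) via the test vector h −
u), with g_N, u_N = sums of interior translates; Cov(j_b, τ_x g) = 0 unless windows meet, E[𝒜_N f] =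
0 exactly, exponential q-mixing of the 1-D Gibbs chain uniformly in N (card crux 1). [deps:
GeneratorCore, GibbsKernelInvariant, ShiftInvariantGibbsState] [difficulty: L] -/
@[route_item "route-AtomisticToContinuum-AbelianSqueeze"]
def ResolventSqueeze : Prop :=
  ∀ ω₂ lam β γ : ℝ, 0 < ω₂ → 0 < lam → 0 < β → 0 < γ → ∀ T : ℝ, 0 < T → ∀ μT : MeasureTheory.Measure Literature.MathematicalPhysics.KineticTheory.HeatConduction.ChainConfig, (Literature.MathematicalPhysics.KineticTheory.HeatConduction.pinnedChain ω₂ lam β γ).IsChainGibbsMeasure T μT → Literature.Barriers.AtomisticToContinuum.HeatConduction.IsShiftInvariant μT → let br : (Literature.MathematicalPhysics.KineticTheory.HeatConduction.ChainConfig → ℝ) → (Literature.MathematicalPhysics.KineticTheory.HeatConduction.ChainConfig → ℝ) → ℝ := fun f₁ f₂ => ∑' x : ℤ, ((∫ σ, f₁ σ * f₂ (fun i => σ (i + x)) ∂μT) - (∫ σ, f₁ σ ∂μT) * (∫ σ, f₂ σ ∂μT)); let jZ : Literature.MathematicalPhysics.KineticTheory.HeatConduction.ChainConfig → ℝ :=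 fun σ => (Literature.MathematicalPhysics.KineticTheory.HeatConduction.pinnedChain ω₂ lam β γ).bondCurrentZ σ 0; ∀ ν : ℝ, 0 < ν → ∀ g u : Literature.MathematicalPhysics.KineticTheory.HeatConduction.ChainConfig → ℝ, Literature.Barriers.AtomisticToContinuum.HeatConduction.IsLocalTestFunction g → Literature.Barriers.AtomisticToContinuum.HeatConduction.IsLocalTestFunction u → ∀ ε : ℝ, 0 < ε → ∃ N₀ : ℕ, ∀ N : ℕ, N₀ ≤ N → let J : Literature.MathematicalPhysics.KineticTheory.HeatConduction.PhaseSpace N → ℝ := fun z => ∑ i : Fin N, (Literature.MathematicalPhysics.KineticTheory.HeatConduction.pinnedChain ω₂ lam β γ).bondCurrent N i z; let F : ℝ := ∫ t in Set.Ioi (0:ℝ), Real.exp (-(ν * t)) * ∫ z, J z * (∫ y, J y ∂((Literature.MathematicalPhysics.KineticTheory.HeatConduction.pinnedChain ω₂ lam β γ).transitionKernel N T T t.toNNReal z)) ∂((Literature.MathematicalPhysics.KineticTheory.HeatConduction.pinnedChain ω₂ lam β γ).gibbsMeasure N T); ((N:ℝ) - 1) * ((2 * br jZ g - ν * br g g -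 ν⁻¹ * br ((Literature.MathematicalPhysics.KineticTheory.HeatConduction.pinnedChain ω₂ lam β γ).liouvilleZ g) ((Literature.MathematicalPhysics.KineticTheory.HeatConduction.pinnedChain ω₂ lam β γ).liouvilleZ g)) - ε) ≤ F ∧ F ≤ ((N:ℝ) - 1) * ((ν⁻¹ * br (jZ + (Literature.MathematicalPhysics.KineticTheory.HeatConduction.pinnedChain ω₂ lam β γ).liouvilleZ u) (jZ + (Literature.MathematicalPhysics.KineticTheory.HeatConduction.pinnedChain ω₂ lam β γ).liouvilleZ u) + ν * br u u) + ε)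

/-- item stmt-AtomisticToContinuum-4933 · crux · rank 4 · closed · moot by None · by planner
why it might fail: Printed only as an ASSUMPTION for unbounded V″ (BernardinOlla2011 p. 11/13: 'easily proved if V″ bounded … proofs should be quite technical'); needs covariance-summed locality of the infinite quartic-coupling dynamics (BCDM 2007: harmonic coupling only); a deficiency vector = a non-local slow mode.
sources: MarchioroPellegrinottiPulvirenti1978, BernardinOlla2011, doi:10.1007/bf01197331, doi:10.1007/s10955-007-9278-0, LanfordLebowitzLieb1977
[crux] (G) for pinnedChain (all > 0), T > 0, the shift-invariant DLR state μ_T and every ν > 0: for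
every ε > 0 there are local test functions g, u with DUAL_ν(u) ≤ PRIMAL_ν(g) + ε (no duality gap; by
Fenchel–Rockafellar inf DUAL = sup of PRIMAL over the maximal domain D(𝒜₀*), so the item says local
functions are a core: essential skew-adjointness of the Liouvillian on local functions in ℋ₀(μ_T),
the translation-summed analogue of MarchioroPellegrinottiPulvirenti1978). [deps:
ShiftInvariantGibbsState] [difficulty: L] -/
@[route_item "route-AtomisticToContinuum-AbelianSqueeze"]
def LiouvilleNoGap : Prop :=
  ∀ ω₂ lam β γ : ℝ, 0 < ω₂ → 0 < lam → 0 < β → 0 < γ → ∀ T : ℝ, 0 < T → ∀ μT : MeasureTheory.Measure Literature.MathematicalPhysics.KineticTheory.HeatConduction.ChainConfig, (Literature.MathematicalPhysics.KineticTheory.HeatConduction.pinnedChain ω₂ lam β γ).IsChainGibbsMeasure T μT → Literature.Barriers.AtomisticToContinuum.HeatConduction.IsShiftInvariant μT → let br : (Literature.MathematicalPhysics.KineticTheory.HeatConduction.ChainConfig → ℝ) → (Literature.MathematicalPhysics.KineticTheory.HeatConduction.ChainConfig → ℝ) → ℝ := fun f₁ f₂ => ∑' x : ℤ, ((∫ σ,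 f₁ σ * f₂ (fun i => σ (i + x)) ∂μT) - (∫ σ, f₁ σ ∂μT) * (∫ σ, f₂ σ ∂μT)); let jZ : Literature.MathematicalPhysics.KineticTheory.HeatConduction.ChainConfig → ℝ := fun σ => (Literature.MathematicalPhysics.KineticTheory.HeatConduction.pinnedChain ω₂ lam β γ).bondCurrentZ σ 0; ∀ ν : ℝ, 0 < ν → ∀ ε : ℝ, 0 < ε → ∃ g u : Literature.MathematicalPhysics.KineticTheory.HeatConduction.ChainConfig → ℝ, Literature.Barriers.AtomisticToContinuum.HeatConduction.IsLocalTestFunction g ∧ Literature.Barriers.AtomisticToContinuum.HeatConduction.IsLocalTestFunction u ∧ (ν⁻¹ * br (jZ + (Literature.MathematicalPhysics.KineticTheory.HeatConduction.pinnedChain ω₂ lam β γ).liouvilleZ u) (jZ + (Literature.MathematicalPhysics.KineticTheory.HeatConduction.pinnedChain ω₂ lam β γ).liouvilleZ u) + ν * br u u) ≤ (2 * br jZ g - ν * br g g - ν⁻¹ * br ((Literature.MathematicalPhysics.KineticTheory.HeatConduction.pinnedChain ω₂ lam β γ).liouvilleZ g) ((Literature.MathematicalPhysics.KineticTheory.HeatConduction.pinnedChain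 ω₂ lam β γ).liouvilleZ g)) + ε

/-- item stmt-AtomisticToContinuum-4934 · crux · rank 5 · closed · moot by None · by planner
why it might fail: Needs NESS = invariant law of the constructed semigroup (FP-identification half of 0741), differentiability of μ_(T±δ/2)(J) at δ = 0 with the exchange of δ→0 and t→∞ (weighted spectral gap, CEHR (2.5)), and KDN's Novikov / time-reversal steps made honest for polynomially unbounded J.
sources: KunduDharNarayan2009, arXiv:0809.4543, ReyBellet2003, HairerMajda2009, CuneoEckmannHairerReyBellet2018, BonettoLebowitzReyBellet2000
[crux] (K) under weak-NESS uniqueness, for every steady-state family, T > 0, N and every response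
coefficient D of clause (ii) (D = lim_(δ→0,δ≠0) totalCurrent(μ N (T+δ/2) (T−δ/2))/δ): t ↦ c_N(t) is
integrable on (0,∞) and (N−1)·T²·D = ∫₀^∞ c_N(t) dt — the Kundu–Dhar–Narayan open-system Green–Kubo
identity G = (k_B T²)⁻¹∫₀^∞⟨j̄(t)j̄(0)⟩dt, j̄ = J/(N−1), made a theorem for the Langevin-bath pinned
chain (N = 0, 1: both sides vanish). [deps: NessUnique, GibbsKernelInvariant] [difficulty: M] -/
@[route_item "route-AtomisticToContinuum-AbelianSqueeze"]
def KuboAbelIdentity : Prop :=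
  ∀ ω₂ lam β γ : ℝ, 0 < ω₂ → 0 < lam → 0 < β → 0 < γ → (∀ (N : ℕ) (T_L T_R : ℝ), 0 < T_L → 0 < T_R → ∀ μ ν : MeasureTheory.Measure (Literature.MathematicalPhysics.KineticTheory.HeatConduction.PhaseSpace N), (Literature.MathematicalPhysics.KineticTheory.HeatConduction.pinnedChain ω₂ lam β γ).IsSteadyState N T_L T_R μ → (Literature.MathematicalPhysics.KineticTheory.HeatConduction.pinnedChain ω₂ lam β γ).IsSteadyState N T_L T_R ν → μ = ν) → ∀ μ : (N : ℕ) → ℝ → ℝ → MeasureTheory.Measure (Literature.MathematicalPhysics.KineticTheory.HeatConduction.PhaseSpace N), (∀ (N : ℕ) (T_L T_R : ℝ), 0 < T_L → 0 < T_R → (Literature.MathematicalPhysics.KineticTheory.HeatConduction.pinnedChain ω₂ lam β γ).IsSteadyState N T_L T_R (μ N T_L T_R)) → ∀ T : ℝ, 0 < T → ∀ N : ℕ, ∀ D : ℝ, Filter.Tendsto (fun δ : ℝ => (Literature.MathematicalPhysics.KineticTheory.HeatConduction.pinnedChain ω₂ lam β γ).totalCurrent (μ N (T + δ / 2) (T -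 δ / 2)) / δ) (nhdsWithin 0 {(0 : ℝ)}ᶜ) (nhds D) → let J : Literature.MathematicalPhysics.KineticTheory.HeatConduction.PhaseSpace N → ℝ := fun z => ∑ i : Fin N, (Literature.MathematicalPhysics.KineticTheory.HeatConduction.pinnedChain ω₂ lam β γ).bondCurrent N i z; MeasureTheory.IntegrableOn (fun t : ℝ => ∫ z, J z * (∫ y, J y ∂((Literature.MathematicalPhysics.KineticTheory.HeatConduction.pinnedChain ω₂ lam β γ).transitionKernel N T T t.toNNReal z)) ∂((Literature.MathematicalPhysics.KineticTheory.HeatConduction.pinnedChain ω₂ lam β γ).gibbsMeasure N T)) (Set.Ioi 0) ∧ ((N:ℝ) - 1) * T ^ 2 * D = ∫ t in Set.Ioi (0:ℝ), ∫ z, J z * (∫ y, J y ∂((Literature.MathematicalPhysics.KineticTheory.HeatConduction.pinnedChain ω₂ lam β γ).transitionKernel N T T t.toNNReal z)) ∂((Literature.MathematicalPhysics.KineticTheory.HeatConduction.pinnedChain ω₂ lam β γ).gibbsMeasure N T)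

/-- item stmt-AtomisticToContinuum-2193 · crux · rank 6 · closed · moot by None · by planner
why it might fail: No N-uniform lower bound on the NESS current of a deterministic anharmonic chain is in print; asymptotic localisation (DeRoeckHuveneers2015) makes c(T) super-polynomially small at low T·lam; a genuine failure (D_N → 0) would refute the conjunct itself.
sources: DeRoeckHuveneers2015, BonettoLebowitzReyBellet2000, BernardinOlla2005, Dhar2008
[crux] NOT INSULATING: for pinnedChain ω₂ lam β γ (all > 0), under weak-NESS uniqueness, for every
steady-state family, T > 0 and the response coefficients D_N: ∃ c = c(ω₂,lam,β,γ,T) > 0 and N₁ with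
D_N ≥ c for all N ≥ N₁ (liminf_N D_N > 0; equivalently J_N ≥ c·δT/(N−1) to first order: an Ohmic
LOWER bound). NECESSARY for the conjunct (D_N → κ(T) > 0). In the Assembly it caps the Fekete slope:
R_N/N ≤ 1/c, i.e. κ ≥ c. No N-uniform lower bound on the NESS current of a deterministic anharmonic
chain is in print; candidate engines (sibling idea cards): linear-response fluctuation-theorem /
thermodynamic-uncertainty bounds on the conductance from the √t bond-heat variance, comparison with
the energy-conserving-noise chain where κ ≥ c is a theorem (BernardinOlla2005,
BasileBernardinOlla2009), multi-scale pigeonhole on the response temperature profile; ALTERNATIVE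
SUPPLIER inside this route: SubadditiveResistance ∧ PositiveConductance ⇒ R_N ≤ K·N ⇒ D_N ≥ 1/(2K)
(support items). By the scaling conjugacy c(T) may decay super-polynomially in regimes of asymptotic
localisation (DeRoeckHuveneers2015) — allowed at fixed T. -/
@[route_item "route-AtomisticToContinuum-AbelianSqueeze"]
def ConductanceLowerBound : Prop :=
  ∀ ω₂ lam β γ : ℝ, 0 < ω₂ → 0 < lam → 0 < β → 0 < γ → (∀ (N : ℕ) (T_L T_R : ℝ), 0 < T_L → 0 < T_R → ∀ μ ν : MeasureTheory.Measure (Literature.MathematicalPhysics.KineticTheory.HeatConduction.PhaseSpace N), (Literature.MathematicalPhysics.KineticTheory.HeatConduction.pinnedChain ω₂ lam β γ).IsSteadyState N T_L T_R μ → (Literature.MathematicalPhysics.KineticTheory.HeatConduction.pinnedChain ω₂ lam β γ).IsSteadyState N T_L T_R ν → μ = ν) → ∀ μ : (N : ℕ) → ℝ → ℝ → MeasureTheory.Measure (Literature.MathematicalPhysics.KineticTheory.HeatConduction.PhaseSpace N), (∀ (N : ℕ) (T_L T_R : ℝ), 0 < T_L → 0 < T_R → (Literature.MathematicalPhysics.KineticTheory.HeatConduction.pinnedChain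 ω₂ lam β γ).IsSteadyState N T_L T_R (μ N T_L T_R)) → ∀ T : ℝ, 0 < T → ∀ D : ℕ → ℝ, (∀ N : ℕ, Filter.Tendsto (fun δ : ℝ => (Literature.MathematicalPhysics.KineticTheory.HeatConduction.pinnedChain ω₂ lam β γ).totalCurrent (μ N (T + δ / 2) (T - δ / 2)) / δ) (nhdsWithin 0 {(0 : ℝ)}ᶜ) (nhds (D N))) → ∃ c : ℝ, 0 < c ∧ ∃ N₁ : ℕ, ∀ N : ℕ, N₁ ≤ N → c ≤ D N

/-- item stmt-AtomisticToContinuum-0717 · support · rank 9 · closed · proved by Summit.AtomisticToContinuum.FouriersLaw.Theorems.FourierGreenKubo.finiteResponseOfUnique_holds (prover) · by planner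
sources: ReyBellet2003, HairerMajda2009, CuneoEckmannHairerReyBellet2018
CONDITIONAL FORM OF 0705 (supersedes it as the prover target; refuters pool-5/g3-0: 0705 stand-alone
quantifies over EVERY steady-state family and is false-prone if weak steady states were non-unique):
assuming UNIQUENESS of weak steady states (IsSteadyState class) for pinnedChain at all N, T_L, T_R >
0, the finite-N linear-response limit D_N(T) = lim_{δ→0, δ≠0} totalCurrent(μ_{N,T+δ/2,T−δ/2})/δ
exists for every T > 0 and N. Content: differentiability at equilibrium of NESS expectations of the
polynomial currents in the bath temperatures (ReyBellet2003 arXiv:math-ph/0303021 Rem 4.4 (51)–(56)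
finite-volume Green–Kubo; HairerMajda2009 arXiv:0909.4313 Thm 2.3 framework — their SDE Thm 4.4
Assumption 5 fails here, so verify Assumptions 1–3 via CEHR2018 (2.5)/Carmona2007 Thm 1.1(iv)
weighted spectral gap). N = 0, 1: totalCurrent ≡ 0, D = 0. Together with 0706 gives 0705. -/
@[route_item "route-AtomisticToContinuum-AbelianSqueeze"]
def FiniteResponseOfUnique : Prop :=
  ∀ ω₂ lam β γ : ℝ, 0 < ω₂ → 0 < lam → 0 < β → 0 < γ → (∀ (N : ℕ) (T_L T_R : ℝ), 0 < T_L → 0 < T_R → ∀ μ ν : MeasureTheory.Measure (Literature.MathematicalPhysics.KineticTheory.HeatConduction.PhaseSpace N), (Literature.MathematicalPhysics.KineticTheory.HeatConduction.pinnedChain ω₂ lam β γ).IsSteadyState N T_L T_R μ → (Literature.MathematicalPhysics.KineticTheory.HeatConduction.pinnedChain ω₂ lam β γ).IsSteadyState N T_L T_R ν → μ = ν) → ∀ μ : (N : ℕ) → ℝ → ℝ → MeasureTheory.Measure (Literature.MathematicalPhysics.KineticTheory.HeatConduction.PhaseSpace N), (∀ (N : ℕ) (T_L T_R : ℝ), 0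 < T_L → 0 < T_R → (Literature.MathematicalPhysics.KineticTheory.HeatConduction.pinnedChain ω₂ lam β γ).IsSteadyState N T_L T_R (μ N T_L T_R)) → ∀ T : ℝ, 0 < T → ∀ N : ℕ, ∃ D : ℝ, Filter.Tendsto (fun δ : ℝ => (Literature.MathematicalPhysics.KineticTheory.HeatConduction.pinnedChain ω₂ lam β γ).totalCurrent (μ N (T + δ / 2) (T - δ / 2)) / δ) (nhdsWithin 0 {(0 : ℝ)}ᶜ) (nhds D)

/-- item stmt-AtomisticToContinuum-0741 · support · rank 9 · closed · proved by Summit.AtomisticToContinuum.FouriersLaw.Theorems.nessUnique_proof (prover) · by planner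
sources: CuneoEckmannHairerReyBellet2018, Carmona2007
[crux] UNIQUENESS OF THE WEAK STEADY STATE (the half of stmt-0706 not covered by the landed fact
Literature.MathematicalPhysics.KineticTheory.HeatConduction.CuneoEckmannHairerReyBellet2018_pinnedChain,
p3544): for pinnedChain ω₂ lam β γ (all > 0), every N and T_L, T_R > 0, any two measures in the weak
Fokker–Planck class IsSteadyState (probability, ∫ L f dμ = 0 for f ∈ C_c^∞, bond currents
integrable) coincide. Print: uniqueness of the INVARIANT MEASURE of the Langevin semigroup
(CuneoEckmannHairerReyBellet2018 Thm 2.13(1): C1, C2, CA; Carmona2007 Thm 1.1(iii)); the item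
additionally needs 'weak stationary probability solution of L*μ = 0 ⇒ P_t-invariant' for this
hypoelliptic L with cubic drift (Echeverría 1982 well-posed martingale problem on C_c^∞ +
non-explosion via e^{θH}; Bogachev–Krylov–Röckner–Shaposhnikov 2015 Ch. 5 is non-degenerate only) —
the FP-identification lemma is the formal crux. N = 0: PhaseSpace 0 is a point (unique probability
measure); N = 1: both baths on site 0, OU at temperature (T_L+T_R)/2. This is exactly the hypothesis
of FiniteResponse and ThermodynamicLimit and, with the fact, gives clause (i) of FouriersLawFor. -/
@[route_item "route-AtomisticToContinuum-AbelianSqueeze"]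
def NessUnique : Prop :=
  ∀ ω₂ lam β γ : ℝ, 0 < ω₂ → 0 < lam → 0 < β → 0 < γ → ∀ (N : ℕ) (T_L T_R : ℝ), 0 < T_L → 0 < T_R → ∀ μ ν : MeasureTheory.Measure (Literature.MathematicalPhysics.KineticTheory.HeatConduction.PhaseSpace N), (Literature.MathematicalPhysics.KineticTheory.HeatConduction.pinnedChain ω₂ lam β γ).IsSteadyState N T_L T_R μ → (Literature.MathematicalPhysics.KineticTheory.HeatConduction.pinnedChain ω₂ lam β γ).IsSteadyState N T_L T_R ν → μ = ν

/-- `NessUnique` holds: proved by `Summit.AtomisticToContinuum.FouriersLaw.Theorems.nessUnique_proof`. -/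
theorem NessUnique_holds : NessUnique := _root_.Summit.AtomisticToContinuum.FouriersLaw.Theorems.nessUnique_proof

/-- item stmt-AtomisticToContinuum-4935 · support · rank 9 · closed · moot by None · by planner
sources: LanfordLebowitzLieb1977, KomorowskiLandimOlla2012
[support] for pinnedChain (all > 0) and T > 0 a shift-invariant DLR Gibbs state μ_T on (ℝ×ℝ)^ℤ
exists (1-D transfer operator e^(−U/2T)e^(−V(q′−q)/T)e^(−U/2T), Hilbert–Schmidt with simple top
eigenvalue; momenta i.i.d. Gaussian). It instantiates μT in (S),(G); uniqueness among
shift-invariant DLR states (tight boundary values + uniform forgetting) is a lemma of the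
(S)-prover, not an item. [difficulty: provable-now] -/
@[route_item "route-AtomisticToContinuum-AbelianSqueeze"]
def ShiftInvariantGibbsState : Prop :=
  ∀ ω₂ lam β γ : ℝ, 0 < ω₂ → 0 < lam → 0 < β → 0 < γ → ∀ T : ℝ, 0 < T → ∃ μT : MeasureTheory.Measure Literature.MathematicalPhysics.KineticTheory.HeatConduction.ChainConfig, (Literature.MathematicalPhysics.KineticTheory.HeatConduction.pinnedChain ω₂ lam β γ).IsChainGibbsMeasure T μT ∧ Literature.Barriers.AtomisticToContinuum.HeatConduction.IsShiftInvariant μT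

/-- item stmt-AtomisticToContinuum-4936 · support · rank 9 · closed · moot by None · by planner
sources: CuneoEckmannHairerReyBellet2018, BonettoLebowitzReyBellet2000
[support] at equal bath temperatures the Gibbs measure gibbsMeasure N T is invariant under the
constructed transition kernels transitionKernel N T T t for every t (so P_t is a contraction
semigroup on L²(μ_N) and F_N(ν), c_N are junk-free); infinitesimal invariance is in tree
(pinnedChain_isSteadyState_gibbsMeasure). [difficulty: M] -/
@[route_item "route-AtomisticToContinuum-AbelianSqueeze"]
def GibbsKernelInvariant : Prop :=
  ∀ ω₂ lam β γ : ℝ, 0 < ω₂ → 0 < lam → 0 < β → 0 < γ → ∀ (N : ℕ) (T : ℝ), 0 < T → ∀ t : NNReal, ((Literature.MathematicalPhysics.KineticTheory.HeatConduction.pinnedChain ω₂ lam β γ).gibbsMeasure N T).bind ⇑((Literature.MathematicalPhysics.KineticTheory.HeatConduction.pinnedChain ω₂ lam β γ).transitionKernel N T T t) = (Literature.MathematicalPhysics.KineticTheory.HeatConduction.pinnedChain ω₂ lam β γ).gibbsMeasure N T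

/-- item stmt-AtomisticToContinuum-4937 · support · rank 9 · closed · moot by None · by planner
sources: doi:10.1007/b104762, doi:10.1007/s00028-010-0064-0, BernardinOlla2011
[support] essential m-dissipativity of the equal-temperature generator L = 𝒜_H + γS on C_c^∞ in
L²(gibbsMeasure N T): for ν > 0, an L² function orthogonal to (ν − L)C_c^∞ vanishes; hence the L²
semigroup of the constructed kernels is generated by the closure of L, L̄* ⊇ (−𝒜_H + γS)|C_c^∞,
Re⟨L̄h,h⟩ = −γT Σ_bath‖∂_p h‖² — the functional-analytic input of the fixed-N weak-duality
inequalities in (S). Energy cut-offs χ(H/k) commute with 𝒜_H exactly. [difficulty: M] -/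
@[route_item "route-AtomisticToContinuum-AbelianSqueeze"]
def GeneratorCore : Prop :=
  ∀ ω₂ lam β γ : ℝ, 0 < ω₂ → 0 < lam → 0 < β → 0 < γ → ∀ (N : ℕ) (T : ℝ), 0 < T → ∀ ν : ℝ, 0 < ν → ∀ h : Literature.MathematicalPhysics.KineticTheory.HeatConduction.PhaseSpace N → ℝ, MeasureTheory.MemLp h 2 ((Literature.MathematicalPhysics.KineticTheory.HeatConduction.pinnedChain ω₂ lam β γ).gibbsMeasure N T) → (∀ f : Literature.MathematicalPhysics.KineticTheory.HeatConduction.PhaseSpace N → ℝ, ContDiff ℝ ((⊤ : ℕ∞) : WithTop ℕ∞) f → HasCompactSupport f → ∫ z, h z * (ν * f z - (Literature.MathematicalPhysics.KineticTheory.HeatConduction.pinnedChain ω₂ lam β γ).generator N T T f z) ∂((Literature.MathematicalPhysics.KineticTheory.HeatConduction.pinnedChain ω₂ lam β γ).gibbsMeasure N T) = 0) → h =ᵐ[(Literature.MathematicalPhysics.KineticTheory.HeatConduction.pinnedChain ω₂ lam β γ).gibbsMeasure N T] 0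

/-- item stmt-AtomisticToContinuum-4938 · assembly · rank 1 · closed · moot by None · by planner
sources: BonettoLebowitzReyBellet2000, KunduDharNarayan2009
[assembly] NessUnique → FiniteResponseOfUnique → KuboAbelIdentity → ResolventSqueeze →
LiouvilleNoGap → UniformAbelianRegularity → ConductanceLowerBound → ShiftInvariantGibbsState →
FouriersLaw. -/
@[route_item "route-AtomisticToContinuum-AbelianSqueeze"]
def Assembly : Prop :=
  NessUnique → FiniteResponseOfUnique → KuboAbelIdentity → ResolventSqueeze → LiouvilleNoGap → UniformAbelianRegularity → ConductanceLowerBound → ShiftInvariantGibbsState → Literature.MathematicalPhysics.KineticTheory.HeatConduction.FouriersLaw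

end Summit.AtomisticToContinuum.FouriersLaw.Theses.AbelianSqueeze
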